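import Literature.MathematicalPhysics.KineticTheory.HardSphereEulerProofs
import Literature.Probability.Distributions.GaussianCoordinateMoments

/-!
# The Gibbs-mixture wall, core I: Gaussian integrals and the second-order remainder
# (line `FirstLemma`, crux stmt-AtomisticToContinuum-14135 `AntiMazurCoboundaries.CorrectorPressureDecay`; lead seat c9)

First helper file of the registered stub `gibbsMixtureWall_holds : GibbsMixtureWall` (…KiferWallMacroErgodic.lean: the
wall inequality for translation-invariant mixtures of hard-sphere Gibbs states), namespace
`Summit.AtomisticToContinuum.HydrodynamicLimit.Theorems.KiferCompactification`. Its analytic heart is the GAUSSIAN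
SECOND-ORDER LEMMA (piece (P2) of the lead's design, proved in …KiferGibbsMixtureWallGauss.lean): for continuous
`|g| ≤ 1` orthogonal to `1, v, |v|²` in `L²(N(0, I))`, `|E_{N(a, rI)} g| ≤ C · KL(N(a, rI) ‖ N(0, I))` with a universal
`C`. The proof is an `L²` computation — by orthogonality `E_{N(a,rI)} g = ∫ g (L_{a,r} - T_{a,r}) dN(0,I)` for the
likelihood ratio `L_{a,r} = dN(a,rI)/dN(0,I)` and its first-order Taylor polynomial `T_{a,r} = 1 + ⟨a,w⟩ + ((r-1)/2)(|w|²-3)`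
at `(a, r) = (0, 1)`, so `|E g| ≤ ‖L - T‖_{L²(N(0,I))}`, and `‖L - T‖² = ∫L² - 2∫LT + ∫T²` is EXPLICIT — and this file
supplies its ingredients:

* `gmw_integral_localMaxwellian_sq_div` — THE CHI-SQUARE INTEGRAL OF THE GAUSSIAN FAMILY on `ℝ³`:
  `∫ ψ_{a,r}²/φ dv = (r(2-r))^{-3/2} exp(|a|²/(2-r))` for `0 < r < 2` (completing the square, Mathlib's
  `GaussianFourier.integral_rexp_neg_mul_sq_norm`, and the bookkeeping of the normalising constants
  `gmw_gauss_const_identity`);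
* the Gaussian moments entering `∫ T²`: `E⟨a,w⟩ = 0`, `E⟨a,w⟩² = |a|²`, `E|w|² = 3`, odd moments vanish
  (`gmw_integral_eq_zero_of_odd_stdGaussian`), and `E(|w|² - 3)² = 6` (`gmw_integral_norm_sq_sub_three_sq_stdGaussian`,
  from the fourth moment `E X⁴ = 3` of `N(0,1)` — fourth derivative of the moment generating function `e^{t²/2}` — and
  the additivity of the variance over the independent coordinates);
* the conversions between `N(0,I)`-, `N(a,rI)`- and Lebesgue integrals (`gmw_integral_stdGaussian_eq_integral_mul`,
  `gmw_integrable_stdGaussian_iff`, `gmw_integrable_localMaxwellian_mul_iff`);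
* `c9_gaussian_remainder_le_sq_entropy` (MAIN, registered): THE SECOND-ORDER REMAINDER IS DOMINATED BY THE ENTROPY near
  `(0, 1)`: for `t = |a|² ≤ 1/8`, `|r - 1| ≤ 1/8`,
  `(r(2-r))^{-3/2} e^{t/(2-r)} - 2(1 + t + ((r-1)/2)(t + 3(r-1))) + (1 + t + 3(r-1)²/2) ≤ 25 ((t + 3(r - 1 - log r))/2)²`
  (the three terms are `∫L²`, `∫LT`, `∫T²`; elementary: `(1-u²)^{-3/2} ≤ 1 + 3u²/2 + 4u⁴`, `e^τ ≤ 1 + τ + τ²`,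
  `u - log(1+u) ≥ 5u²/14`, after which the remainder vanishes to fourth order), together with the far-field entropy
  floor `gmw_sub_one_sub_log_ge_of_far`: `r - 1 - log r ≥ 5/896` for `|r - 1| ≥ 1/8`.
-/

noncomputable section

open MeasureTheory ProbabilityTheory Real Filter
open scoped ENNReal NNReal InnerProductSpace

namespace Summit.AtomisticToContinuum.HydrodynamicLimit.Theorems.KiferCompactification

open Literature.MathematicalPhysics.KineticTheory (V3 gaussMeasure withDensity_localMaxwellian_eq_gaussMeasure
  integral_norm_sq_stdGaussian integrable_norm_sq_stdGaussian integrable_norm_pow_four_stdGaussian continuous_localMaxwellian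
  localMaxwellian_nonneg)
open Literature.Analysis.FluidPDE (globalMaxwellian localMaxwellian globalMaxwellian_pos continuous_globalMaxwellian)

/-! ## Integrals against Gaussian densities on `ℝ³` -/

/-- Integrability with respect to a measure with a nonnegative real density. -/
theorem gmw_integrable_withDensity_ofReal_iff {ρ : V3 → ℝ} (hρm : Measurable ρ) (hρ : ∀ v, 0 ≤ ρ v) (G : V3 → ℝ) :
    Integrable G ((volume : Measure V3).withDensity fun v => ENNReal.ofReal (ρ v)) ↔
      Integrable (fun v => ρ v * G v) := by
  rw [show (fun v : V3 => ENNReal.ofReal (ρ v)) = fun v => ((ρ v).toNNReal : ℝ≥0∞) from rfl,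
    integrable_withDensity_iff_integrable_smul hρm.real_toNNReal]
  refine integrable_congr (Eventually.of_forall fun v => ?_)
  simp only [NNReal.smul_def, smul_eq_mul, Real.coe_toNNReal _ (hρ v)]

/-- The standard Gaussian on `ℝ³` is the law with density the global Maxwellian. -/
theorem gmw_stdGaussian_V3_eq :
    stdGaussian V3 = (volume : Measure V3).withDensity fun v => ENNReal.ofReal (globalMaxwellian v) :=
  Literature.Analysis.FluidPDE.stdGaussian_eq_withDensity_globalMaxwellian_holds

/-- `∫ G dN(0, I) = ∫ φ G dv`. -/
theorem gmw_integral_stdGaussian_eq_integral_mul (G : V3 → ℝ) :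
    ∫ w, G w ∂stdGaussian V3 = ∫ v, globalMaxwellian v * G v := by
  rw [gmw_stdGaussian_V3_eq, Literature.Analysis.FluidPDE.integral_withDensity_globalMaxwellian]
  rfl

/-- `G ∈ L¹(N(0, I))` iff `φ G ∈ L¹(dv)`. -/
theorem gmw_integrable_stdGaussian_iff (G : V3 → ℝ) :
    Integrable G (stdGaussian V3) ↔ Integrable (fun v => globalMaxwellian v * G v) := by
  rw [gmw_stdGaussian_V3_eq]
  exact gmw_integrable_withDensity_ofReal_iff continuous_globalMaxwellian.measurable (fun v => (globalMaxwellian_pos v).le) G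

/-- `ψ_{a,r} G ∈ L¹(dv)` iff `G ∈ L¹(N(a, rI))`. -/
theorem gmw_integrable_localMaxwellian_mul_iff {r : ℝ} (hr : 0 < r) (a : V3) (G : V3 → ℝ) :
    Integrable (fun v => localMaxwellian 1 r a v * G v) ↔ Integrable G (gaussMeasure a r) := by
  rw [← withDensity_localMaxwellian_eq_gaussMeasure hr a]
  exact (gmw_integrable_withDensity_ofReal_iff (continuous_localMaxwellian 1 r a).measurable
    (fun v => localMaxwellian_nonneg zero_le_one hr.le a v) G).symm

/-- Gaussian functions are integrable on `ℝ³`. -/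
theorem gmw_integrable_rexp_neg_mul_sq_norm {b : ℝ} (hb : 0 < b) : Integrable (fun v : V3 => rexp (-b * ‖v‖ ^ 2)) := by
  by_contra h
  have h0 := integral_undef h
  rw [GaussianFourier.integral_rexp_neg_mul_sq_norm hb] at h0
  exact (Real.rpow_pos_of_pos (by positivity) _).ne' h0

/-! ## Moments of the standard Gaussian -/

/-- `E (|w|² − 3)² = 6` under the standard Gaussian on `ℝ³` (`E|w|⁴ = 15`, `E|w|² = 3`: the variance of a `χ²₃` variable). -/
theorem gmw_integral_norm_sq_sub_three_sq_stdGaussian : ∫ w, (‖w‖ ^ 2 - 3) ^ 2 ∂stdGaussian V3 = 6 := by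
  have h4 := Literature.Probability.Distributions.integral_norm_pow_four_stdGaussian (EuclideanSpace.basisFun (Fin 3) ℝ)
  have h2 : ∫ w, ‖w‖ ^ 2 ∂stdGaussian V3 = 3 := by
    rw [show stdGaussian V3 = stdGaussian (EuclideanSpace ℝ (Fin 3)) from rfl, integral_norm_sq_stdGaussian,
      Fintype.card_fin, Nat.cast_ofNat]
  have h4i : Integrable (fun w : V3 => ‖w‖ ^ 4 - 6 * ‖w‖ ^ 2) (stdGaussian V3) :=
    (integrable_norm_pow_four_stdGaussian (ι := Fin 3)).sub ((integrable_norm_sq_stdGaussian (ι := Fin 3)).const_mul 6)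
  have hpt : ∀ w : V3, (‖w‖ ^ 2 - 3) ^ 2 = ‖w‖ ^ 4 - 6 * ‖w‖ ^ 2 + 9 := fun w => by ring
  simp_rw [hpt]
  rw [integral_add h4i (integrable_const _), integral_sub (integrable_norm_pow_four_stdGaussian (ι := Fin 3))
    ((integrable_norm_sq_stdGaussian (ι := Fin 3)).const_mul 6), integral_const_mul, integral_const, probReal_univ,
    show stdGaussian V3 = stdGaussian (EuclideanSpace ℝ (Fin 3)) from rfl, h4, h2]
  norm_num [Fintype.card_fin]

/-- `E ⟨a, w⟩ = 0`. -/
theorem gmw_integral_inner_stdGaussian (a : V3) : ∫ w, ⟪a, w⟫_ℝ ∂stdGaussian V3 = 0 := by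
  simpa only [innerSL_apply_apply] using integral_strongDual_stdGaussian (innerSL ℝ a : StrongDual ℝ V3)

/-- `⟨a, ·⟩` has all moments. -/
theorem gmw_memLp_inner_stdGaussian (a : V3) (p : ℝ≥0∞) (hp : p ≠ ∞) : MemLp (fun w : V3 => ⟪a, w⟫_ℝ) p (stdGaussian V3) := by
  have hfun : (fun w : V3 => ⟪a, w⟫_ℝ) = ⇑(innerSL ℝ a : StrongDual ℝ V3) :=
    funext fun w => (innerSL_apply_apply ℝ a w).symm
  rw [hfun]
  exact IsGaussian.memLp_dual (stdGaussian V3) (innerSL ℝ a : StrongDual ℝ V3) p hp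

/-- `E ⟨a, w⟩² = |a|²`. -/
theorem gmw_integral_inner_sq_stdGaussian (a : V3) : ∫ w, ⟪a, w⟫_ℝ ^ 2 ∂stdGaussian V3 = ‖a‖ ^ 2 := by
  have hv := variance_dual_stdGaussian (innerSL ℝ a : StrongDual ℝ V3)
  rw [innerSL_apply_norm, variance_of_integral_eq_zero (innerSL ℝ a : StrongDual ℝ V3).continuous.aemeasurable
    (integral_strongDual_stdGaussian _)] at hv
  simpa only [innerSL_apply_apply] using hv

/-- `|w|²` has a second moment. -/
theorem gmw_memLp_two_norm_sq_stdGaussian : MemLp (fun w : V3 => ‖w‖ ^ 2) 2 (stdGaussian V3) := by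
  rw [memLp_two_iff_integrable_sq (by fun_prop)]
  exact (integrable_norm_pow_four_stdGaussian (ι := Fin 3)).congr (Eventually.of_forall fun w => by ring)

/-! ## The chi-square integral of the Gaussian family -/

/-- The normalising constants: `(2πr)^{-3} (2π)^{3/2} (π/s)^{3/2} = (r(2-r))^{-3/2}` for `s = 1/r - 1/2`, `0 < r < 2`. -/
theorem gmw_gauss_const_identity {r : ℝ} (hr : 0 < r) (hr2 : r < 2) :
    ((2 * π * r) ^ (-(3 : ℝ) / 2)) ^ 2 / (2 * π) ^ (-(3 : ℝ) / 2) * (π / (1 / r - 1 / 2)) ^ ((3 : ℝ) / 2) =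
      (r * (2 - r)) ^ (-(3 : ℝ) / 2) := by
  have h2r : 0 < 2 - r := by linarith
  have hπ : 0 < π := pi_pos
  rw [show (1 : ℝ) / r - 1 / 2 = (2 - r) / (2 * r) by field_simp, neg_div,
    Real.rpow_neg (by positivity), Real.rpow_neg (by positivity), Real.rpow_neg (by positivity),
    Real.mul_rpow (by positivity) hr.le, Real.mul_rpow (by positivity) hπ.le, Real.div_rpow hπ.le (by positivity),
    Real.div_rpow h2r.le (by positivity), Real.mul_rpow (by positivity) hr.le, Real.mul_rpow hr.le h2r.le]
  have hA : 0 < (2 : ℝ) ^ ((3 : ℝ) / 2) := by positivity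
  have hP : 0 < π ^ ((3 : ℝ) / 2) := by positivity
  have hR : 0 < r ^ ((3 : ℝ) / 2) := by positivity
  have hQ : 0 < (2 - r) ^ ((3 : ℝ) / 2) := Real.rpow_pos_of_pos h2r _
  field_simp

/-- Completing the square: `ψ_{a,r}(v)² / φ(v)` is a Gaussian function of `v` (`0 < r < 2`). -/
theorem gmw_localMaxwellian_sq_div_globalMaxwellian {r : ℝ} (hr : 0 < r) (hr2 : r < 2) (a v : V3) :
    localMaxwellian 1 r a v ^ 2 / globalMaxwellian v =
      ((2 * π * r) ^ (-(3 : ℝ) / 2)) ^ 2 / (2 * π) ^ (-(3 : ℝ) / 2) * rexp (‖a‖ ^ 2 / (2 - r)) *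
        rexp (-(1 / r - 1 / 2) * ‖v - (2 / (2 - r)) • a‖ ^ 2) := by
  have h2r : (2 : ℝ) - r ≠ 0 := by linarith
  have hexp : rexp (-‖v - a‖ ^ 2 / (2 * r)) ^ 2 / rexp (-‖v‖ ^ 2 / 2) =
      rexp (‖a‖ ^ 2 / (2 - r)) * rexp (-(1 / r - 1 / 2) * ‖v - (2 / (2 - r)) • a‖ ^ 2) := by
    rw [sq, ← Real.exp_add, ← Real.exp_sub, ← Real.exp_add]
    congr 1
    rw [norm_sub_sq_real, norm_sub_sq_real, inner_smul_right, norm_smul, mul_pow, Real.norm_eq_abs, sq_abs]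
    field_simp
    ring
  simp only [localMaxwellian, globalMaxwellian, finrank_euclideanSpace_fin, Nat.cast_ofNat, one_mul]
  rw [mul_pow, show ((2 * π * r) ^ (-(3 : ℝ) / 2)) ^ 2 / (2 * π) ^ (-(3 : ℝ) / 2) * rexp (‖a‖ ^ 2 / (2 - r)) *
      rexp (-(1 / r - 1 / 2) * ‖v - (2 / (2 - r)) • a‖ ^ 2) = ((2 * π * r) ^ (-(3 : ℝ) / 2)) ^ 2 /
      (2 * π) ^ (-(3 : ℝ) / 2) * (rexp (-‖v - a‖ ^ 2 / (2 * r)) ^ 2 / rexp (-‖v‖ ^ 2 / 2)) by rw [hexp]; ring]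
  have hβ : (2 * π) ^ (-(3 : ℝ) / 2) ≠ 0 := (Real.rpow_pos_of_pos (by positivity) _).ne'
  have hE : rexp (-‖v‖ ^ 2 / 2) ≠ 0 := (Real.exp_pos _).ne'
  field_simp

/-- **The chi-square integral of the Gaussian family**: `∫ ψ_{a,r}² / φ = (r(2-r))^{-3/2} e^{|a|²/(2-r)}` for `0 < r < 2`
(`ψ_{a,r}` the density of `N(a, rI)` on `ℝ³`, `φ` the standard Gaussian density). -/
theorem gmw_integral_localMaxwellian_sq_div {r : ℝ} (hr : 0 < r) (hr2 : r < 2) (a : V3) :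
    ∫ v, localMaxwellian 1 r a v ^ 2 / globalMaxwellian v =
      (r * (2 - r)) ^ (-(3 : ℝ) / 2) * rexp (‖a‖ ^ 2 / (2 - r)) := by
  have hs : 0 < 1 / r - 1 / 2 := by rwa [sub_pos, one_div_lt_one_div two_pos hr]
  simp_rw [gmw_localMaxwellian_sq_div_globalMaxwellian hr hr2 a]
  rw [integral_const_mul]
  have ht := integral_sub_right_eq_self (μ := (volume : Measure V3))
    (fun w : V3 => rexp (-(1 / r - 1 / 2) * ‖w‖ ^ 2)) ((2 / (2 - r)) • a)
  rw [ht, GaussianFourier.integral_rexp_neg_mul_sq_norm hs, finrank_euclideanSpace_fin, Nat.cast_ofNat, mul_assoc, mul_comm (rexp _),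
    ← mul_assoc, gmw_gauss_const_identity hr hr2]

/-! ## Elementary inequalities -/

/-- `e^τ ≤ 1 + τ + τ²` for `|τ| ≤ 1`. -/
theorem gmw_exp_le_one_add_add_sq {τ : ℝ} (h : |τ| ≤ 1) : rexp τ ≤ 1 + τ + τ ^ 2 := by
  linarith [(abs_le.1 (Real.abs_exp_sub_one_sub_id_le h)).2]

/-- `log (1 + u) ≤ u - 5u²/14` for `|u| ≤ 1/8` (the cubic remainder of the logarithmic series is at most `u²/7`). -/
theorem gmw_log_one_add_le {u : ℝ} (hu : |u| ≤ 1 / 8) : Real.log (1 + u) ≤ u - 5 * u ^ 2 / 14 := by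
  have hx : |(-u)| < 1 := by rw [abs_neg]; linarith
  have h := Real.abs_log_sub_add_sum_range_le hx 2
  simp only [Finset.sum_range_succ, Finset.range_one, Finset.sum_singleton, Nat.cast_zero, zero_add, pow_one,
    div_one, Nat.cast_one, sub_neg_eq_add, abs_neg] at h
  norm_num at h
  have h3 : |u| ^ 3 / (1 - |u|) ≤ u ^ 2 / 7 := by
    rw [div_le_iff₀ (by linarith [abs_nonneg u])]
    have hu0 := abs_nonneg u
    have : |u| ^ 3 = |u| * u ^ 2 := by rw [pow_succ, pow_succ, pow_one, ← sq_abs]; ring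
    rw [this]
    nlinarith [sq_nonneg u]
  have h4 := (abs_le.1 (h.trans h3)).2
  nlinarith [h4]

/-- `u - log (1 + u) ≥ 5u²/14` for `|u| ≤ 1/8`. -/
theorem gmw_sq_le_sub_log {u : ℝ} (hu : |u| ≤ 1 / 8) : 5 * u ^ 2 / 14 ≤ u - Real.log (1 + u) := by
  linarith [gmw_log_one_add_le hu]

/-- The tangent-line bound of the convex function `r ↦ r - 1 - log r` at `r₀`. -/
theorem gmw_sub_one_sub_log_ge_tangent {r r₀ : ℝ} (hr : 0 < r) (hr₀ : 0 < r₀) :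
    (r₀ - 1 - Real.log r₀) + (1 - 1 / r₀) * (r - r₀) ≤ r - 1 - Real.log r := by
  have h := Real.log_le_sub_one_of_pos (div_pos hr hr₀)
  rw [Real.log_div hr.ne' hr₀.ne'] at h
  have : r / r₀ - 1 = (1 / r₀) * (r - r₀) := by field_simp
  nlinarith [h, this]

/-- Far from `r = 1` the entropy is bounded below: `r - 1 - log r ≥ 5/896` for `|r - 1| ≥ 1/8`, `r > 0`. -/
theorem gmw_sub_one_sub_log_ge_of_far {r : ℝ} (hr : 0 < r) (hfar : 1 / 8 ≤ |r - 1|) : 5 / 896 ≤ r - 1 - Real.log r := by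
  rcases le_or_gt 1 r with h1 | h1
  · rw [abs_of_nonneg (by linarith)] at hfar
    have ht := gmw_sub_one_sub_log_ge_tangent hr (by norm_num : (0 : ℝ) < 9 / 8)
    have hl := gmw_log_one_add_le (u := 1 / 8) (by rw [abs_of_pos (by norm_num)])
    norm_num at ht hl ⊢
    nlinarith [ht, hl, hfar]
  · rw [abs_of_neg (by linarith)] at hfar
    have ht := gmw_sub_one_sub_log_ge_tangent hr (by norm_num : (0 : ℝ) < 7 / 8)
    have hl := gmw_log_one_add_le (u := -(1 / 8)) (by rw [abs_neg, abs_of_pos (by norm_num)])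
    norm_num at ht hl ⊢
    nlinarith [ht, hl, hfar]

/-- The rpow bound `(1 - u²)^{-3/2} ≤ 1 + 3u²/2 + 4u⁴` for `|u| ≤ 1/8`, stated for `r = 1 + u`. -/
theorem gmw_rpow_neg_three_halves_le {r : ℝ} (hu : |r - 1| ≤ 1 / 8) :
    (r * (2 - r)) ^ (-(3 : ℝ) / 2) ≤ 1 + 3 * (r - 1) ^ 2 / 2 + 4 * (r - 1) ^ 4 := by
  set u := r - 1 with hu_def
  have hu2 : u ^ 2 ≤ 1 / 64 := by nlinarith [(abs_le.1 hu).1, (abs_le.1 hu).2]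
  have hx : r * (2 - r) = 1 - u ^ 2 := by rw [hu_def]; ring
  have hxpos : 0 < 1 - u ^ 2 := by linarith
  set P := 1 + 3 * u ^ 2 / 2 + 4 * u ^ 4 with hP
  have hP0 : 0 ≤ P := by positivity
  rw [hx, neg_div, Real.rpow_neg hxpos.le, show (3 : ℝ) / 2 = 1 + 1 / 2 by norm_num, Real.rpow_add hxpos, Real.rpow_one,
    ← Real.sqrt_eq_rpow, inv_le_iff_one_le_mul₀ (by positivity)]
  -- `1 ≤ P (1 - u²) √(1 - u²)` from its square
  have hy0 : 0 ≤ P * ((1 - u ^ 2) * Real.sqrt (1 - u ^ 2)) := by positivity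
  have hsq : 1 ≤ (P * ((1 - u ^ 2) * Real.sqrt (1 - u ^ 2))) ^ 2 := by
    rw [mul_pow, mul_pow, Real.sq_sqrt hxpos.le, hP]
    set x := u ^ 2 with hx_def
    have hx0 : 0 ≤ x := sq_nonneg u
    have hx4 : u ^ 4 = x ^ 2 := by rw [hx_def, ← pow_mul]
    rw [hx4]
    have hkey : (1 + 3 * x / 2 + 4 * x ^ 2) ^ 2 * ((1 - x) ^ 2 * (1 - x)) =
        1 + x ^ 2 * (17 / 4 - 43 / 4 * x + 31 / 4 * x ^ 2 - 89 / 4 * x ^ 3 + 36 * x ^ 4 - 16 * x ^ 5) := by ring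
    have hx21 : x ^ 2 ≤ x := by nlinarith
    have hx3 : x ^ 3 ≤ x := by nlinarith [pow_nonneg hx0 2]
    have hx5 : x ^ 5 ≤ x := by nlinarith [pow_nonneg hx0 2, pow_nonneg hx0 4]
    have hQ : 0 ≤ 17 / 4 - 43 / 4 * x + 31 / 4 * x ^ 2 - 89 / 4 * x ^ 3 + 36 * x ^ 4 - 16 * x ^ 5 := by
      nlinarith [pow_nonneg hx0 2, pow_nonneg hx0 4]
    rw [hkey]
    exact le_add_of_nonneg_right (mul_nonneg (sq_nonneg x) hQ)
  exact (pow_le_pow_iff_left₀ zero_le_one hy0 two_ne_zero).1 (by rwa [one_pow])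

/-- **The second-order remainder is dominated by the entropy** (near `(a, r) = (0, 1)`): with `t = |a|² ≤ 1/8` and
`|r - 1| ≤ 1/8`, `∫ L² - 2 ∫ L T + ∫ T² ≤ 25 D²` where the three integrals are the explicit values computed in this file
and `D = (t + 3(r - 1 - log r))/2`. -/
theorem c9_gaussian_remainder_le_sq_entropy {t r : ℝ} (ht0 : 0 ≤ t) (ht : t ≤ 1 / 8) (hu : |r - 1| ≤ 1 / 8) :
    (r * (2 - r)) ^ (-(3 : ℝ) / 2) * rexp (t / (2 - r)) - 2 * (1 + t + (r - 1) / 2 * (t + 3 * (r - 1))) +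
        (1 + t + 3 * (r - 1) ^ 2 / 2) ≤ 25 * ((t + 3 * (r - 1 - Real.log r)) / 2) ^ 2 := by
  have hP := gmw_rpow_neg_three_halves_le hu
  have hlog : 5 * (r - 1) ^ 2 / 14 ≤ r - 1 - Real.log r := by
    have h := gmw_sq_le_sub_log hu
    rw [add_sub_cancel] at h
    linarith
  have hu' := abs_le.1 hu
  set u := r - 1 with hu_def
  have h2r : 2 - r = 1 - u := by rw [hu_def]; ring
  rw [h2r] at hP ⊢
  set τ := t / (1 - u) with hτ_def
  have h1u : 7 / 8 ≤ 1 - u := by linarith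
  have hτ0 : 0 ≤ τ := div_nonneg ht0 (by linarith)
  have hτt : τ * (1 - u) = t := by rw [hτ_def]; field_simp
  have hτ1 : τ ≤ 1 / 7 := by rw [hτ_def, div_le_iff₀ (by linarith)]; linarith
  have hexp : rexp τ ≤ 1 + τ + τ ^ 2 := gmw_exp_le_one_add_add_sq (by rw [abs_of_nonneg hτ0]; linarith)
  have hprod : (r * (1 - u)) ^ (-(3 : ℝ) / 2) * rexp τ ≤ (1 + 3 * u ^ 2 / 2 + 4 * u ^ 4) * (1 + τ + τ ^ 2) :=
    mul_le_mul hP hexp (Real.exp_pos τ).le (by positivity)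
  have hD : (t + 15 * u ^ 2 / 14) / 2 ≤ (t + 3 * (r - 1 - Real.log r)) / 2 := by linarith
  have hD0 : 0 ≤ (t + 15 * u ^ 2 / 14) / 2 := by positivity
  have hDsq := pow_le_pow_left₀ hD0 hD 2
  have hu2τ : 0 ≤ u ^ 2 * τ := mul_nonneg (sq_nonneg u) hτ0
  have hu4 : 0 ≤ u ^ 4 := by positivity
  have ha : u ^ 2 * τ ^ 2 ≤ u ^ 2 * τ / 7 := by
    have h := mul_le_mul_of_nonneg_left hτ1 hu2τ
    linarith
  have hb : u ^ 4 * τ ≤ u ^ 4 / 7 := by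
    have h := mul_le_mul_of_nonneg_left hτ1 hu4
    linarith
  have hc : u ^ 4 * τ ^ 2 ≤ u ^ 4 / 49 := by
    have h := mul_le_mul_of_nonneg_left (pow_le_pow_left₀ hτ0 hτ1 2) hu4
    linarith
  have hd0 : 0 ≤ 7 * τ / 8 + 15 * u ^ 2 / 14 := by positivity
  have hd : (7 * τ / 8 + 15 * u ^ 2 / 14) ^ 2 ≤ (τ * (1 - u) + 15 * u ^ 2 / 14) ^ 2 := by
    refine pow_le_pow_left₀ hd0 ?_ 2
    linarith [mul_nonneg hτ0 (show 0 ≤ 1 / 8 - u by linarith)]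
  calc (r * (1 - u)) ^ (-(3 : ℝ) / 2) * rexp τ - 2 * (1 + t + u / 2 * (t + 3 * u)) + (1 + t + 3 * u ^ 2 / 2)
      ≤ (1 + 3 * u ^ 2 / 2 + 4 * u ^ 4) * (1 + τ + τ ^ 2) - 2 * (1 + t + u / 2 * (t + 3 * u)) +
          (1 + t + 3 * u ^ 2 / 2) := by linarith
    _ = τ ^ 2 + 5 / 2 * (u ^ 2 * τ) + 3 / 2 * (u ^ 2 * τ ^ 2) + 4 * (u ^ 4 + u ^ 4 * τ + u ^ 4 * τ ^ 2) := by
          rw [← hτt]; ring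
    _ ≤ 25 * ((7 * τ / 8 + 15 * u ^ 2 / 14) ^ 2 / 4) := by linarith [sq_nonneg τ]
    _ ≤ 25 * ((t + 15 * u ^ 2 / 14) / 2) ^ 2 := by rw [← hτt]; linarith [hd]
    _ ≤ 25 * ((t + 3 * (r - 1 - Real.log r)) / 2) ^ 2 := by linarith [hDsq]


end Summit.AtomisticToContinuum.HydrodynamicLimit.Theorems.KiferCompactification

end
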